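import Summits.BirchSwinnertonDyer.Rank1Residual.X11b.HalvesReceptacle
import Mathlib.Analysis.Analytic.IsolatedZeros
import Mathlib.Analysis.Analytic.OfScalars
import HarnessLib

/-!
# X11b — rigidity of a BDP frame: an element of `R₀⟦T⟧` is determined by its values on any sequence
# of points of the open disc accumulating at `T = 0`; two `L` with the SAME interpolation data
# `IsBDPLFunction ι 𝔭 κ γ f Ω_K Ω_p ·` coincide, given a supply of interpolation characters whose
# avatars accumulate at the trivial character

HONEST FRAMING (cell `b2b-bsdres`, run/shared/lean/b2b/bsd-rank1-residual/, verbatim in every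
file): the goal of the cell is to DELETE the COMBINATION-SHAPED residual classes of the
Birch–Swinnerton-Dyer formula for ALL analytic-rank `≤ 1` elliptic curves over `ℚ` — "full BSD
formula for every rank `≤ 1` curve in class `C`" assembled STRICTLY from published theorems — so
that the rank-`≤ 1` remainder becomes exactly the CONSTRUCTION-SHAPED classes, which are TYPED
(missing-input `Prop`s), NOT attempted. This is not "finishing BSD". Sub-cell
`b2b-bsdres-multr1-p1` (X11b, route R1, gen 22); THEOREMS ONLY (no definition, no named fact, no
`sorry`); valid at every prime `p`; nothing here changes a label.

## Why this file

The registry types Castella's `L_p(f)` (Cas18 Thm. 3.1) through the CHARACTERISING PREDICATE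
`IsBDPLFunction ι 𝔭 κ γ f Ω_K Ω_p L` (interpolation at the unramified anticyclotomic Hecke characters
`φ` of infinity type `(-n, n)`, `n > 0`, whose `p`-adic avatar factors through `Γ`) with the CM
periods and `L` quantified EXISTENTIALLY, and the cell's typed open inputs over such frames come in
two currencies: ∀-frame (gen 20/21: `R1.IMCEqOnTree`, `R1.BDPValueOnTree`; x11b3's `…At₃` shapes)
and ∃-frame (gen 22: `R1.IMCEqFrameOnTree`). The referee's nit `named-fact-over-underdetermined-
predicate` (R121.2, cyclotomic case) asks exactly whether such a predicate pins `L`. This file proves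
the anticyclotomic analogue of the tree's `MemIwasawaRat.eq_zero_of_forall_hasSum_zero` /
`eq_zero_of_bounded_of_forall_character_hasSum_zero` (cyclotomic interpolants):

* `eq_zero_of_norm_le_of_hasSum_zero_of_tendsto_zero` — IDENTITY PRINCIPLE at `0` for BOUNDED
  power series over `ℂ_p`: if `‖c_n‖ ≤ C` and `∑ c_n x_k^n = 0` along a sequence `x_k → 0` with
  `x_k ≠ 0` infinitely often, then `c = 0`. (The sum `z ↦ ∑ c_n z^n` is analytic on the open unit
  disc — radius `≥ 1` by the bound —; by the principle of isolated zeros (Mathlib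
  `AnalyticAt.frequently_zero_iff_eventually_zero`) it vanishes near `0`, so its power series at `0`
  is zero (`HasFPowerSeriesAt.eq_zero`). No Weierstrass preparation is needed, so the coefficient
  ring may be any bounded subring of `ℂ_p`, e.g. `R₀`, where the tree's `Λ ⊗ ℚ_p` argument does not
  apply; the price is that the zeros must ACCUMULATE at an interior point — a bounded series over
  `ℂ_p` may have infinitely many zeros tending to the rim.) Cf. Strassmann's theorem
  (Cassels, *Local Fields*, Ch. 4 Thm. 4.1) for series converging on the closed disc.
* `unrSeries_eq_of_hasValueAt` — two elements of `R₀⟦T⟧ = Λ_{R₀}` with the same values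
  (`UnrSeries.HasValueAt`) along such a sequence are EQUAL (`‖R₀‖ ≤ 1`, `HalvesReceptacle`).
* **`isBDPLFunction_unique_of_tendsto`** — FRAME RIGIDITY AT FIXED PERIODS: if `L`, `L'` both satisfy
  `IsBDPLFunction ι 𝔭 κ γ f Ω_K Ω_p ·` and there is a SUPPLY of interpolation data
  `(φ_k, n_k, r_k)_k` (each `φ_k` unramified of infinity type `(-n_k, n_k)`, `n_k > 0`, with avatar
  `r_k` through `κ`) whose avatar values `φ̂_k(γ) → 1` with `φ̂_k(γ) ≠ 1` infinitely often, then
  `L = L'`. In nature such a supply always exists (the powers `φ₀^{m p^k}` of any one interpolation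
  character: `φ̂₀(γ)` is a principal unit, so `φ̂₀(γ)^{p^k} → 1`), but the tree has no construction
  of anticyclotomic Hecke characters of prescribed infinity type, so the supply is a HYPOTHESIS here.
  `isBDPLFunction_forall_of_exists_of_tendsto`: consequently, AT FIXED PERIODS, "some `L` of the
  frame has property `P`" and "every `L` of the frame has property `P`" agree.

WHAT THIS DOES NOT DO: frames with DIFFERENT periods `(Ω_K, Ω_p) ≠ (Ω_K', Ω_p')` are not compared
(their `L` differ by the factor `n ↦ (ι⁻¹(Ω_K/Ω_K')·Ω_p'/Ω_p)^{4n}` on the interpolation range, which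
need not come from a unit of `R₀⟦T⟧`); this is why the registry binds the periods TOGETHER with `L`
(`castella2018_exists_isBDPLFunction`, `Castella2018.thm32_exists_isBDPLFunction_valueAtOne`) and why
route R1's gen-22 attach point is the ∃-frame composite `R1.IMCEqFrameOnTree`, not the ∀-frame H3.

References: [Cassels1986] Ch. 4, Thm. 4.1 (Strassmann) and Ch. 6 §5 (Weierstrass preparation);
[Castella2018] Thm. 3.1 (arXiv:1704.06608 p. 9); [CastellaHsieh2018] §3.3, Def. 3.5, Prop. 3.6.
-/

noncomputable section

open scoped Classical Topology ENNReal NNReal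

open Filter WeierstrassCurve NumberField IsDedekindDomain Field PowerSeries
open Literature.NumberTheory.EllipticCurves
open Literature.NumberTheory.GaloisRepresentations
open Summit.BirchSwinnertonDyer.Rank1Residual.X11b.Halves

namespace Summit.BirchSwinnertonDyer.Rank1Residual.X11b

variable {p : ℕ} [Fact p.Prime]

/-! ### §1 Identity principle at `0` for bounded power series over `ℂ_p` -/

section Identity

/-- **Identity principle at `0` for bounded power series over `ℂ_p`.** If the coefficients
`c_n ∈ ℂ_p` are bounded, and along a sequence `x_k → 0` of points of `ℂ_p` with `x_k ≠ 0`
infinitely often the series `∑_n c_n x_k^n` sums to `0`, then every `c_n` is `0`. Proof: the sum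
`F(z) = ∑ c_n z^n` has `F` as power series on the open unit ball (radius `≥ 1` by the bound); it
vanishes frequently on the punctured neighbourhood of `0`, hence near `0` by the principle of
isolated zeros, so its series at `0` is zero. (Compare Strassmann's theorem, which bounds the number
of zeros of a series converging on the CLOSED disc; here the series is only bounded, and the
accumulation of the zeros at an interior point replaces convergence on the rim.)
[cite: Cassels1986, Ch. 4 Thm. 4.1 (Strassmann; the bounded variant via isolated zeros)] -/
theorem eq_zero_of_norm_le_of_hasSum_zero_of_tendsto_zero {c : ℕ → ℂ_[p]} {C : ℝ}
    (hc : ∀ n, ‖c n‖ ≤ C) {x : ℕ → ℂ_[p]} (hx : Tendsto x atTop (𝓝 0))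
    (hx0 : ∃ᶠ k in atTop, x k ≠ 0) (h : ∀ k, HasSum (fun n ↦ c n * x k ^ n) 0) : c = 0 := by
  let P : FormalMultilinearSeries ℂ_[p] ℂ_[p] ℂ_[p] := FormalMultilinearSeries.ofScalars ℂ_[p] c
  -- radius ≥ 1 from the bound on the coefficients
  have hrad : ((1 : ℝ≥0) : ℝ≥0∞) ≤ P.radius := by
    refine P.le_radius_of_bound C fun n ↦ ?_
    rw [NNReal.coe_one, one_pow, mul_one, FormalMultilinearSeries.ofScalars_norm]
    exact hc n
  have hpos : 0 < P.radius := lt_of_lt_of_le (by simp) hrad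
  have hP : HasFPowerSeriesOnBall P.sum P 0 P.radius := P.hasFPowerSeriesOnBall hpos
  -- the sum vanishes at every `x_k` of norm `< 1`
  have hval : ∀ k, ‖x k‖ < 1 → P.sum (x k) = 0 := by
    intro k hk
    have hy : x k ∈ Metric.eball (0 : ℂ_[p]) P.radius := by
      refine lt_of_lt_of_le ?_ hrad
      rw [edist_zero_right, enorm_eq_nnnorm, ENNReal.coe_lt_coe, ← NNReal.coe_lt_coe, coe_nnnorm,
        NNReal.coe_one]
      exact hk
    have h1 : HasSum (fun n ↦ P n fun _ ↦ x k) (P.sum (x k)) := by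
      simpa only [zero_add] using hP.hasSum hy
    have h2 : HasSum (fun n ↦ P n fun _ ↦ x k) 0 := by
      have hfun : (fun n ↦ P n fun _ ↦ x k) = fun n ↦ c n * x k ^ n := by
        funext n
        rw [FormalMultilinearSeries.ofScalars_apply_eq, smul_eq_mul]
      rw [hfun]
      exact h k
    exact h1.unique h2
  -- hence it vanishes frequently on the punctured neighbourhood of `0`
  have hev1 : ∀ᶠ k in atTop, ‖x k‖ < 1 := by
    have hball : Metric.ball (0 : ℂ_[p]) 1 ∈ 𝓝 (0 : ℂ_[p]) := Metric.ball_mem_nhds 0 one_pos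
    filter_upwards [hx.eventually hball] with k hk
    simpa [Metric.mem_ball, dist_zero_right] using hk
  have hfreq' : ∃ᶠ k in atTop, P.sum (x k) = 0 ∧ x k ∈ ({0}ᶜ : Set ℂ_[p]) := by
    refine (hx0.and_eventually hev1).mono ?_
    rintro k ⟨hk0, hk1⟩
    exact ⟨hval k hk1, hk0⟩
  have hfreq : ∃ᶠ z in 𝓝[≠] (0 : ℂ_[p]), P.sum z = 0 := by
    rw [frequently_nhdsWithin_iff]
    exact hx.frequently hfreq'
  -- isolated zeros: it vanishes near `0`, so its power series at `0` is zero
  have hev : ∀ᶠ z in 𝓝 (0 : ℂ_[p]), P.sum z = 0 :=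
    hP.analyticAt.frequently_zero_iff_eventually_zero.mp hfreq
  have h0 : HasFPowerSeriesAt (0 : ℂ_[p] → ℂ_[p]) P 0 :=
    hP.hasFPowerSeriesAt.congr (hev.mono fun z hz ↦ by rw [hz, Pi.zero_apply])
  have hP0 : P = 0 := h0.eq_zero
  exact (FormalMultilinearSeries.ofScalars_series_eq_zero ℂ_[p]).mp hP0

/-- **Identity principle at `0` for power series over a bounded subring `φ : R ↪ ℂ_p`**: if the
images of the coefficients of `A ∈ R⟦T⟧` are bounded and `A` vanishes (`∑ φ(a_n) x_k^n = 0`) along a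
sequence `x_k → 0` with `x_k ≠ 0` infinitely often, then `A = 0`.
[cite: Cassels1986, Ch. 4 Thm. 4.1 (Strassmann; the bounded variant via isolated zeros)] -/
theorem powerSeries_eq_zero_of_hasSum_zero_of_tendsto_zero {R : Type*} [CommRing R]
    {φ : R →+* ℂ_[p]} (hφ : Function.Injective φ) {A : PowerSeries R} {C : ℝ}
    (hA : ∀ n, ‖φ (PowerSeries.coeff n A)‖ ≤ C) {x : ℕ → ℂ_[p]} (hx : Tendsto x atTop (𝓝 0))
    (hx0 : ∃ᶠ k in atTop, x k ≠ 0)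
    (h : ∀ k, HasSum (fun n ↦ φ (PowerSeries.coeff n A) * x k ^ n) 0) : A = 0 := by
  have key := eq_zero_of_norm_le_of_hasSum_zero_of_tendsto_zero hA hx hx0 h
  ext n
  have hn := congrFun key n
  rw [Pi.zero_apply, ← map_zero φ] at hn
  rw [map_zero]
  exact hφ hn

end Identity

/-! ### §2 `R₀⟦T⟧`: values along a sequence accumulating at the trivial character determine `L` -/

section UnrSeriesRigidity

/-- **An element of `Λ_{R₀} = R₀⟦T⟧` is determined by its values on a sequence of characters
accumulating at `𝟙`.** If `L, L' ∈ R₀⟦T⟧` take the same value (`UnrSeries.HasValueAt`, a `HasSum`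
in `ℂ_p`) at every point `x_k` of a sequence `x_k → 0` with `x_k ≠ 0` infinitely often, then
`L = L'` (coefficients of `R₀` have norm `≤ 1`, `norm_coe_unrIntegers_le_one`; identity principle
for the difference). [cite: Cassels1986, Ch. 4 Thm. 4.1 (Strassmann; the bounded variant via isolated zeros)] -/
theorem unrSeries_eq_of_hasValueAt {L L' : UnrSeries p} {x v : ℕ → ℂ_[p]}
    (hx : Tendsto x atTop (𝓝 0)) (hx0 : ∃ᶠ k in atTop, x k ≠ 0)
    (hL : ∀ k, L.HasValueAt (x k) (v k)) (hL' : ∀ k, L'.HasValueAt (x k) (v k)) : L = L' := by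
  have key : (fun n ↦ ((PowerSeries.coeff n L : unrIntegers p) : ℂ_[p]) -
      ((PowerSeries.coeff n L' : unrIntegers p) : ℂ_[p])) = 0 := by
    refine eq_zero_of_norm_le_of_hasSum_zero_of_tendsto_zero (C := 1 + 1) (fun n ↦ ?_) hx hx0
      fun k ↦ ?_
    · exact (norm_sub_le _ _).trans
        (add_le_add (norm_coe_unrIntegers_le_one p _) (norm_coe_unrIntegers_le_one p _))
    · have hsub := (hL k).sub (hL' k)
      rw [sub_self] at hsub
      refine hsub.congr_fun fun n ↦ ?_
      rw [sub_mul]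
  refine PowerSeries.ext fun n ↦ Subtype.ext ?_
  have hn := congrFun key n
  rwa [Pi.zero_apply, sub_eq_zero] at hn

end UnrSeriesRigidity

/-! ### §3 Frame rigidity at fixed periods for `IsBDPLFunction` -/

section Frame

variable {K : Type} [Field K] [NumberField K] {N : ℕ} {ι : PadicAlgCl p ≃+* ℂ}
  {𝔭 : HeightOneSpectrum (𝓞 K)} {κ : ZpExtension K p} {γ : Field.absoluteGaloisGroup K}
  {f : CuspForm (CongruenceSubgroup.Gamma0 N) 2} {ΩK : ℂ} {Ωp : ℂ_[p]}

/-- **Frame rigidity at fixed periods.** Two series `L, L' ∈ R₀⟦T⟧` with the SAME interpolation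
data — `IsBDPLFunction ι 𝔭 κ γ f Ω_K Ω_p L` and `IsBDPLFunction ι 𝔭 κ γ f Ω_K Ω_p L'` (Castella 2018,
Thm. 3.1: values at the avatars `φ̂` of the unramified anticyclotomic `φ` of infinity type `(-n, n)`,
`n > 0`) — are EQUAL, provided a SUPPLY of interpolation data `(φ_k, n_k, r_k)` (`φ_k` unramified of
type `(-n_k, n_k)`, `n_k > 0`, `r_k` its `p`-adic avatar through `κ`) with `φ̂_k(γ) → 1` in `ℂ_p` and
`φ̂_k(γ) ≠ 1` infinitely often: both series take the prescribed value at `T = φ̂_k(γ) - 1 → 0`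
(`IsBDPLFunction.hasValueAt`), and `unrSeries_eq_of_hasValueAt` applies. (In nature the powers
`φ₀^{m p^k}` of one interpolation character are such a supply; the tree does not construct Hecke
characters of prescribed infinity type, so the supply is a hypothesis.) Frames with different
periods are NOT compared. [cite: Castella2018, Thm. 3.1 (arXiv:1704.06608 p. 9)]
[cite: CastellaHsieh2018, §3.3, Def. 3.5 and Prop. 3.6 (the interpolation property characterising ℒ_{𝔭,ψ}(f))] -/
theorem isBDPLFunction_unique_of_tendsto {L L' : UnrSeries p}
    (hL : IsBDPLFunction ι 𝔭 κ γ f ΩK Ωp L) (hL' : IsBDPLFunction ι 𝔭 κ γ f ΩK Ωp L')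
    {φ : ℕ → HeckeCharacter K} {n : ℕ → ℕ} {r : ℕ → FramedGaloisRep K (PadicAlgCl p) 1}
    (hn : ∀ k, 0 < n k) (hunr : ∀ k (v : HeightOneSpectrum (𝓞 K)), (φ k).IsUnramifiedAt v)
    (hinf : ∀ k, (φ k).HasInfinityType (fun _ ↦ (n k : ℤ)) (fun _ ↦ -(n k : ℤ)))
    (hr : ∀ k, IsPAdicAvatarOf ι (φ k) (r k)) (hκ : ∀ k, FactorsThroughZp κ (r k))
    (hlim : Tendsto (fun k ↦ avatarValueAt (r k) γ) atTop (𝓝 1))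
    (hne : ∃ᶠ k in atTop, avatarValueAt (r k) γ ≠ 1) : L = L' := by
  refine unrSeries_eq_of_hasValueAt (x := fun k ↦ avatarValueAt (r k) γ - 1)
    (v := fun k ↦ ((ι.symm (bdpInterpolationValue p f 𝔭 (φ k) (n k) ΩK) : PadicAlgCl p) : ℂ_[p]) *
      Ωp ^ (4 * n k)) ?_ ?_
    (fun k ↦ hL.hasValueAt (hn k) (hunr k) (hinf k) (hr k) (hκ k))
    (fun k ↦ hL'.hasValueAt (hn k) (hunr k) (hinf k) (hr k) (hκ k))
  · rw [← sub_self (1 : ℂ_[p])]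
    exact hlim.sub_const 1
  · exact hne.mono fun k hk ↦ sub_ne_zero.mpr hk

/-- **At fixed periods, "some `L` of the frame" = "every `L` of the frame".** Under the supply
hypothesis of `isBDPLFunction_unique_of_tendsto`: if SOME `L` with `IsBDPLFunction ι 𝔭 κ γ f Ω_K Ω_p L`
has a property `P` (e.g. a value formula at `𝟙`, a main-conjecture identity), then EVERY `L'` with
the same interpolation data has it. This is the exact sense in which the registry's ∃∧-typed
statements about Castella's `L_p(f)` (periods bound together with `L`) speak about ONE series.
[cite: Castella2018, Thm. 3.1 (arXiv:1704.06608 p. 9)] -/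
theorem isBDPLFunction_forall_of_exists_of_tendsto {P : UnrSeries p → Prop}
    {φ : ℕ → HeckeCharacter K} {n : ℕ → ℕ} {r : ℕ → FramedGaloisRep K (PadicAlgCl p) 1}
    (hn : ∀ k, 0 < n k) (hunr : ∀ k (v : HeightOneSpectrum (𝓞 K)), (φ k).IsUnramifiedAt v)
    (hinf : ∀ k, (φ k).HasInfinityType (fun _ ↦ (n k : ℤ)) (fun _ ↦ -(n k : ℤ)))
    (hr : ∀ k, IsPAdicAvatarOf ι (φ k) (r k)) (hκ : ∀ k, FactorsThroughZp κ (r k))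
    (hlim : Tendsto (fun k ↦ avatarValueAt (r k) γ) atTop (𝓝 1))
    (hne : ∃ᶠ k in atTop, avatarValueAt (r k) γ ≠ 1)
    (hex : ∃ L, IsBDPLFunction ι 𝔭 κ γ f ΩK Ωp L ∧ P L) {L' : UnrSeries p}
    (hL' : IsBDPLFunction ι 𝔭 κ γ f ΩK Ωp L') : P L' := by
  obtain ⟨L, hL, hP⟩ := hex
  rwa [isBDPLFunction_unique_of_tendsto hL hL' hn hunr hinf hr hκ hlim hne] at hP

end Frame

end Summit.BirchSwinnertonDyer.Rank1Residual.X11b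

end
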